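import Literature.IUT.HodgeArakelov.AbsTopInterfaces

/-!
# [IUTchII] §1, Example 1.8 (viii): the printed assertions, over the typed interface (PROOF-ONLY companion)

Mochizuki, *Inter-universal Teichmüller theory II*, §1, Example 1.8 (viii), kurims manuscript (Dec. 2020)
pp. 40–41 [claim: Mochizuki2012, status: disputed] (IUTchII §1 Ex 1.8 (viii), kurims pp.40-41). Record-only, under
the claim key `Mochizuki2012` (D-0012, disputed). PROOF-ONLY companion of `RadialExamples.lean` (p406303: the
ENVIRONMENT of (viii) has the shape `ex18iii S Γ`) and `AbsTopInterfaces.lean` (p407495: the [AbsTopIII] output data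
`AbsTopMonoids`, `ProfiniteGroupifications` composing the printed diagram `α_{⊳,×μ}` —
`M_TM(Π) ↪ M^ĝp_TM(Π) ≅ O^ĝp(G)|_Π ↩ O^×(G)|_Π ↠ O^{×μ}(G)|_Π` — out of `toMghat`, `alphaGhat`, `unitsToOghat`
and the quotient map `O^× ↠ O^{×μ}`). This file adds NO definition; it proves, at the level the interface carries,
the three sentences of (viii) that ASSERT something:

* "(whose associated radial functor is) full and essentially surjective, hence determines a multiradial
  environment" — `ex18viii_full_and_essSurj` (for the typed shape, any twisting group) and, reading "[where one
  takes `Γ^{×μ}` to be the image `Im(Γ)` of `Γ ⊆ Ẑ^×`]" through the interface homomorphism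
  `AbsTopMonoids.toIsm : Ẑ^× → Ism(G)`, `ex18viii_isMultiradial_imToIsm`;
* "here, we note that any such isomorphism `(G ↷ O^ĝp(G)) ≅ (G* ↷ O^ĝp(G*))` induces isomorphisms
  `(G ↷ O^×(G)) ≅ (G* ↷ O^×(G*))`, `(G ↷ O^{×μ}(G)) ≅ (G* ↷ O^{×μ}(G*))` in a fashion compatible with
  `α_{⊳,×μ}, α*_{⊳,×μ}`" — `AbsTopMonoids.ex18viii_existsUnique_units_of_oghat` (an isomorphism of the `O^ĝp`'s
  matching the images of the natural inclusions `↩` restricts UNIQUELY to an isomorphism of the units, by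
  `unitsToOghat_injective`) and `AbsTopMonoids.ex18viii_existsUnique_oxmu_congr` (ANY isomorphism of the units
  descends UNIQUELY along the natural surjections `↠`, torsion being characteristic);
* "a `Γ`-multiple of the isomorphism … induced by an isomorphism of topological groups `G ≅ G*`" on the units,
  i.e. the functorial isomorphism `(G ↷ O^×(G)) ≅ (G* ↷ O^×(G*))` of (iii)/(viii) at interface level
  (`Units.mapEquiv (A.mapOtri f)`): functor laws, compatibility with the inclusion `O^× ⊆ O^⊳`, and
  `G`-equivariance — `ex18viii_unitsMapEquiv_id/_comp`, `ex18viii_val_unitsMapEquiv`,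
  `ex18viii_unitsMapEquiv_equivariant` (from the interface's `mapOtri_id/_comp/_equivariant`).

What is NOT provable here and is recorded, not proved (the interface's own docstring, `ProfiniteGroupifications`):
the `Π`- and `G`-actions on `M^ĝp_TM(Π)`, `O^ĝp(G)` and the functoriality of `(∗ĝp)` in isomorphisms `Π ≅ Π*`,
`G ≅ G*` are not carried, so the bracket "[so one verifies immediately that these isomorphisms are compatible with
`α_{⊳,×μ}, α*_{⊳,×μ}` in the evident sense]" is typed for the arrows `↩`, `↠` (this file) and for the units square of
`≅` (`ProfiniteGroupifications.alphaGhat_compat`), not for the naturality of `↪`/`≅` in `(Π, G)`; ind-topologies are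
not modelled. Nothing here asserts anything about [IUTchIII] Cor. 3.12; typed ≠ proved for the untyped residue.
-/

namespace Literature.IUT.HodgeArakelov

open CategoryTheory

universe u

/-! ## "full and essentially surjective, hence determines a multiradial environment" -/

/-- **IUTchII:Ex1.8(viii)** (kurims p. 41, last sentence of (viii)), PROVED for the typed shape: "The radial algorithm
is the algorithm given by the assignment `(Π ↷ M_TM(Π), G ↷ O^ĝp(G), α_{⊳,×μ}) ↦ (G ↷ O^{×μ}(G))` — whose associated
radial functor is full and essentially surjective, hence determines a multiradial environment." For the environment
shape of record `ex18iii S Γ'` (radial data = pairs, coric data = `Γ'`-twisted isomorphs of `G_k`, radial functor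
the projection) both printed properties hold, for every twisting group `Γ'`.
[claim: Mochizuki2012, status: disputed] (IUTchII §1 Ex 1.8 (viii), kurims p.41) -/
theorem ex18viii_full_and_essSurj (S : ThetaSetting.{u}) (Γ' : Type u) [Group Γ'] :
    (ex18iii S Γ').Φ.Full ∧ (ex18iii S Γ').Φ.EssSurj :=
  ⟨ex18iii_isMultiradial S Γ', (ex18iii S Γ').essSurj⟩

/-- **IUTchII:Ex1.8(viii)** (kurims p. 41), PROVED at the interface's twisting group: "The definition of coric data
and isomorphisms of collections of coric data is the same as in (v) [i.e., where one takes "`Γ^{×μ}`" to be the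
image `Im(Γ)` of `Γ ⊆ Ẑ^×`] … hence determines a multiradial environment" — with `Γ^{×μ} := Im(Γ → Ism(G))`, the
image of the closed subgroup `Γ ⊆ Ẑ^×` under the interface homomorphism `AbsTopMonoids.toIsm G : Ẑ^× → Ism(G)`
("the natural homomorphism `Ẑ^× ↠ ℤ_p^× ↪ Ism(G)`"), the environment `ex18iii S Γ^{×μ}` is multiradial.
[claim: Mochizuki2012, status: disputed] (IUTchII §1 Ex 1.8 (viii), kurims p.41) -/
theorem ex18viii_isMultiradial_imToIsm {S : ThetaSetting.{u}} (A : AbsTopMonoids S)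
    (Γ : Subgroup ZHatUnits) (G : IsoClass S.Gk) :
    (ex18iii S ↥(Γ.map (A.toIsm G))).IsMultiradial :=
  ex18iii_isMultiradial S _

namespace AbsTopMonoids

variable {S : ThetaSetting.{u}} (A : AbsTopMonoids S)

/-! ## "the isomorphism … `(G ↷ O^×(G)) ≅ (G* ↷ O^×(G*))` induced by an isomorphism of topological groups
`G ≅ G*`" — interface level: `Units.mapEquiv (A.mapOtri f)` -/

/-- **IUTchII:Ex1.8(viii)** (kurims p. 41; cf. (iii), p. 38): the isomorphism of units `O^×(G) ≅ O^×(G*)` induced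
by an isomorphism `G ≅ G*` — at interface level the restriction `Units.mapEquiv (A.mapOtri f)` of the induced
isomorphism of `O^⊳`'s — is compatible with the inclusions `O^×(-) ⊆ O^⊳(-)` (PROVED, definitional).
[claim: Mochizuki2012, status: disputed] (IUTchII §1 Ex 1.8 (viii), kurims p.41) -/
theorem ex18viii_val_unitsMapEquiv {G H : IsoClass S.Gk} (f : G ⟶ H) (x : A.Ounits G) :
    ((Units.mapEquiv (A.mapOtri f) x : A.Ounits H) : A.Otri H) = A.mapOtri f (x : A.Otri G) :=
  rfl

/-- **IUTchII:Ex1.8(viii)** (kurims p. 41; cf. (iii), p. 38), PROVED: the induced isomorphisms of units satisfy the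
functor law for identities ("functorial group-theoretic algorithm"), from the interface's `mapOtri_id`.
[claim: Mochizuki2012, status: disputed] (IUTchII §1 Ex 1.8 (viii), kurims p.41) -/
theorem ex18viii_unitsMapEquiv_id (G : IsoClass S.Gk) :
    Units.mapEquiv (A.mapOtri (𝟙 G)) = MulEquiv.refl (A.Ounits G) := by
  apply MulEquiv.ext
  intro x
  ext
  rw [Units.coe_mapEquiv, A.mapOtri_id]
  rfl

/-- **IUTchII:Ex1.8(viii)** (kurims p. 41; cf. (iii), p. 38), PROVED: the induced isomorphisms of units satisfy the
functor law for composites, from the interface's `mapOtri_comp`.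
[claim: Mochizuki2012, status: disputed] (IUTchII §1 Ex 1.8 (viii), kurims p.41) -/
theorem ex18viii_unitsMapEquiv_comp {G H K : IsoClass S.Gk} (f : G ⟶ H) (g : H ⟶ K) :
    Units.mapEquiv (A.mapOtri (f ≫ g)) =
      (Units.mapEquiv (A.mapOtri f)).trans (Units.mapEquiv (A.mapOtri g)) := by
  apply MulEquiv.ext
  intro x
  ext
  rw [Units.coe_mapEquiv, A.mapOtri_comp]
  rfl

/-- **IUTchII:Ex1.8(viii)** (kurims p. 41), PROVED: the induced isomorphism of units is an isomorphism of pairs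
"`(G ↷ O^×(G)) ≅ (G* ↷ O^×(G*))`", i.e. `G`-equivariant along `G ≅ G*` ("ind-topological monoids equipped with
topological group actions"), from the interface's `mapOtri_equivariant`.
[claim: Mochizuki2012, status: disputed] (IUTchII §1 Ex 1.8 (viii), kurims p.41) -/
theorem ex18viii_unitsMapEquiv_equivariant {G H : IsoClass S.Gk} (f : G ⟶ H) (g : G.G) (x : A.Ounits G) :
    Units.mapEquiv (A.mapOtri f) (Units.map (A.actOtri G g).toMonoidHom x) =
      Units.map (A.actOtri H (IsoClass.homIso f g)).toMonoidHom (Units.mapEquiv (A.mapOtri f) x) := by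
  ext
  rw [Units.coe_mapEquiv, Units.coe_map, Units.coe_map, Units.coe_mapEquiv]
  exact A.mapOtri_equivariant f g x

/-! ## "induces isomorphisms … `(G ↷ O^{×μ}(G)) ≅ (G* ↷ O^{×μ}(G*))` in a fashion compatible with `α_{⊳,×μ}`" —
the arrow `↠`: torsion is characteristic, so ANY isomorphism of units descends, uniquely -/

/-- **IUTchII:Ex1.8(viii)** (kurims p. 41), PROVED: "any such isomorphism … induces isomorphisms …
`(G ↷ O^{×μ}(G)) ≅ (G* ↷ O^{×μ}(G*))` in a fashion compatible with `α_{⊳,×μ}, α*_{⊳,×μ}`" — for the last arrow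
`O^×(G) ↠ O^{×μ}(G) = O^×(G)/O^μ(G)` of the diagram: every group isomorphism `u : O^×(G) ≅ O^×(G*)` carries the
torsion subgroup `O^μ(G)` onto `O^μ(G*)`, hence induces a UNIQUE isomorphism `ū : O^{×μ}(G) ≅ O^{×μ}(G*)` with
`ū ∘ (↠) = (↠) ∘ u`. [claim: Mochizuki2012, status: disputed] (IUTchII §1 Ex 1.8 (viii), kurims p.41) -/
theorem ex18viii_existsUnique_oxmu_congr {G H : IsoClass S.Gk} (u : A.Ounits G ≃* A.Ounits H) :
    ∃! ū : A.Oxmu G ≃* A.Oxmu H,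
      ∀ x : A.Ounits G, ū (QuotientGroup.mk x) = QuotientGroup.mk (u x) := by
  refine ⟨QuotientGroup.congr (A.Omu G) (A.Omu H) u u.map_torsion,
    fun x => QuotientGroup.congr_mk (A.Omu G) (A.Omu H) u u.map_torsion x, ?_⟩
  intro e he
  apply MulEquiv.ext
  intro y
  obtain ⟨x, rfl⟩ := QuotientGroup.mk_surjective y
  rw [he x, QuotientGroup.congr_mk]

/-! ## "any such isomorphism `(G ↷ O^ĝp(G)) ≅ (G* ↷ O^ĝp(G*))` induces isomorphisms
`(G ↷ O^×(G)) ≅ (G* ↷ O^×(G*))` … compatible with `α_{⊳,×μ}`" — the arrow `↩`: by injectivity of `O^× ↪ O^ĝp` -/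

/-- **IUTchII:Ex1.8(viii)** (kurims p. 41), PROVED over the interface `ProfiniteGroupifications`: "here, we note that
any such isomorphism `(G ↷ O^ĝp(G)) ≅ (G* ↷ O^ĝp(G*))` induces isomorphisms `(G ↷ O^×(G)) ≅ (G* ↷ O^×(G*))` … in a
fashion compatible with `α_{⊳,×μ}, α*_{⊳,×μ}`" — for the arrow `O^×(G) ↩ O^ĝp(G)` ("the natural inclusion",
`unitsToOghat`, injective): an isomorphism `e : O^ĝp(G) ≅ O^ĝp(G*)` matching the images of the natural inclusions
restricts to a UNIQUE isomorphism of units `u` with `(↩) ∘ u = e ∘ (↩)`. (The isomorphisms "induced by `G ≅ G*`" of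
the text match these images by functoriality of `(∗×) ⊆ (∗ĝp)`; that functoriality of `(∗ĝp)` is not carried by the
interface, whence the hypothesis `he`.) [claim: Mochizuki2012, status: disputed] (IUTchII §1 Ex 1.8 (viii), kurims p.41) -/
theorem ex18viii_existsUnique_units_of_oghat {Γ : Type u} [Group Γ] (B : ProfiniteGroupifications A Γ)
    {G H : IsoClass S.Gk} (e : B.Oghat G ≃* B.Oghat H)
    (he : (B.unitsToOghat G).range.map (e : B.Oghat G →* B.Oghat H) = (B.unitsToOghat H).range) :
    ∃! u : A.Ounits G ≃* A.Ounits H,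
      ∀ x : A.Ounits G, B.unitsToOghat H (u x) = e (B.unitsToOghat G x) := by
  have hG := B.unitsToOghat_injective G
  have hH := B.unitsToOghat_injective H
  refine ⟨((MonoidHom.ofInjective hG).trans ((e.subgroupMap (B.unitsToOghat G).range).trans
      (MulEquiv.subgroupCongr he))).trans (MonoidHom.ofInjective hH).symm, ?_, ?_⟩
  · intro x
    rw [MulEquiv.trans_apply, MonoidHom.apply_ofInjective_symm, MulEquiv.trans_apply, MulEquiv.trans_apply,
      MulEquiv.subgroupCongr_apply, MulEquiv.coe_subgroupMap_apply, MonoidHom.ofInjective_apply]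
  · intro v hv
    apply MulEquiv.ext
    intro x
    apply hH
    rw [hv x, MulEquiv.trans_apply, MonoidHom.apply_ofInjective_symm, MulEquiv.trans_apply, MulEquiv.trans_apply,
      MulEquiv.subgroupCongr_apply, MulEquiv.coe_subgroupMap_apply, MonoidHom.ofInjective_apply]

/-- **IUTchII:Ex1.8(viii)** (kurims p. 41), PROVED (the two previous statements composed): an isomorphism of the
`O^ĝp`'s matching the natural inclusions of units induces a UNIQUE compatible isomorphism of the units AND a UNIQUE
isomorphism of the `O^{×μ}`'s compatible with it along the natural surjections — the arrows `↩ … ↠` of `α_{⊳,×μ}`,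
`α*_{⊳,×μ}` are respected. [claim: Mochizuki2012, status: disputed] (IUTchII §1 Ex 1.8 (viii), kurims p.41) -/
theorem ex18viii_exists_units_oxmu_of_oghat {Γ : Type u} [Group Γ] (B : ProfiniteGroupifications A Γ)
    {G H : IsoClass S.Gk} (e : B.Oghat G ≃* B.Oghat H)
    (he : (B.unitsToOghat G).range.map (e : B.Oghat G →* B.Oghat H) = (B.unitsToOghat H).range) :
    ∃ (u : A.Ounits G ≃* A.Ounits H) (ū : A.Oxmu G ≃* A.Oxmu H),
      (∀ x : A.Ounits G, B.unitsToOghat H (u x) = e (B.unitsToOghat G x)) ∧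
      (∀ x : A.Ounits G, ū (QuotientGroup.mk x) = QuotientGroup.mk (u x)) := by
  obtain ⟨u, hu, -⟩ := A.ex18viii_existsUnique_units_of_oghat B e he
  obtain ⟨ū, hū, -⟩ := A.ex18viii_existsUnique_oxmu_congr u
  exact ⟨u, ū, hu, hū⟩

end AbsTopMonoids

end Literature.IUT.HodgeArakelov
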